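import Summits.HubbardSuperconductivity.HubbardLadder.Bounds.FdcEvalBridge
import HarnessLib

/-!
# Bridge (continued): contraction sums and the closed-form FDC energy of the circuit `F31`

HONEST FRAMING: ladder R1–R4 with certified numbers; no claim on H/H₀; bounds for model classes,
no materials claim.

The conjugated one- and two-site plaquette operators `uHatᴴ (κ s)_p uHat`,
`uHatᴴ (κ s)_p (κ' s')_{p+eᵢ} uHat` have entries `κ XI/SCALE²`, `κκ' XBI/SCALE²`; the contraction
sums of `FdcTwoTilingEnergy` at `(phiHat, uHat)` are `fdcSumA = κκ' IAdir/(SCALE⁴ N2⁸)` and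
`fdcSumB = κκ' IB/(SCALE² N2⁴)` (`κκ' = ¼` for `SᶻSᶻ`, `1` for `S^±S^∓`); with the spin-½ matrices
`Sᶻ = ½ sz2`, `S⁺ = sp`, `S⁻ = sm` this gives the formula `fdcEnergy_phiHat_uHat`:
`Φ(phiHat, uHat) = Σ_{m,i} bondVal m i`, a rational function of the 24 integer sums `IAdir i m t`
(A classes, `pbit i m = 0`) and `IB m i t` (B classes). [folklore]
-/

namespace Summit.HubbardSuperconductivity.HubbardLadder.Bounds

open Matrix Finset Complex
open Literature.Probability.LatticeModels Literature.MathematicalPhysics.QuantumLattice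

noncomputable section

/-- `(N2 : ℂ) ≠ 0` — private file-internal copy (the public helper of `FdcEvalBridge` was made
`private` after a `dedup.landed` printed-form match with an unrelated landed lemma). [folklore] -/
private theorem N2_cast_ne_zero : (N2 : ℂ) ≠ 0 := by norm_num [N2]

/-- `(SCALE : ℂ) ≠ 0` — private file-internal copy, same reason. [folklore] -/
private theorem SCALE_cast_ne_zero : (SCALE : ℂ) ≠ 0 := by norm_num [SCALE]

/-! ### Conjugated plaquette operators -/

/-- Entries of `uHatᴴ (κ s at p) uHat`. [folklore] -/
theorem conj_onSite_entry (p : FdcP) (κ : ℂ) (s : Fin 2 → Fin 2 → ℤ) (j j' : Fin 16) :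
    (uHatᴴ * onSite p (κ • castM s) * uHat) (cfgEquiv j) (cfgEquiv j') =
      κ * ((XI (posEquiv p) s j j' : ℤ) : ℂ) / (SCALE : ℂ) ^ 2 := by
  have hcore : (UCᴴ * onSite p (castM s) * UC) (cfgEquiv j) (cfgEquiv j') =
      ((XIdir (posEquiv p) s j j' : ℤ) : ℂ) := by
    rw [Matrix.mul_apply]
    simp only [Matrix.mul_apply, sum_cfg, conjTranspose_apply, UC_cfgEquiv, star_intCast,
      onSite_cfgEquiv, castM_apply]
    push_cast [XIdir, osI_cast]
    rfl
  unfold uHat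
  simp only [onSite_smul, conjTranspose_smul, Matrix.smul_mul, Matrix.mul_smul, smul_smul,
    Matrix.smul_apply, smul_eq_mul]
  rw [hcore, XIdir_eq_XI, Complex.star_def, map_inv₀, map_natCast]
  have hS := SCALE_cast_ne_zero
  field_simp

/-- `p + eᵢ ≠ p`. [folklore] -/
theorem add_single_ne (p : FdcP) (i : Fin 2) : p ≠ p + Pi.single i 1 := by
  intro h
  have h' := congrArg posEquiv h
  rw [posEquiv_add_single] at h'
  exact pflip_ne i (posEquiv p) h'.symm

/-- Entries of `uHatᴴ (κ s at p)(κ' s' at p + eᵢ) uHat`. [folklore] -/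
theorem conj_onSite_onSite_entry (p : FdcP) (i : Fin 2) (κ κ' : ℂ) (s s' : Fin 2 → Fin 2 → ℤ)
    (j j' : Fin 16) :
    (uHatᴴ * (onSite p (κ • castM s) * onSite (p + Pi.single i 1) (κ' • castM s')) * uHat :
        Op FdcP 2) (cfgEquiv j) (cfgEquiv j') =
      κ * κ' * ((XBI (posEquiv p) s (pflip i (posEquiv p)) s' j j' : ℤ) : ℂ) / (SCALE : ℂ) ^ 2 := by
  have hcore : (UCᴴ * (onSite p (castM s) * onSite (p + Pi.single i 1) (castM s')) * UC :
      Op FdcP 2) (cfgEquiv j) (cfgEquiv j') =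
      ((XBIdir (posEquiv p) s (pflip i (posEquiv p)) s' j j' : ℤ) : ℂ) := by
    set O : Op FdcP 2 := onSite p (castM s) * onSite (p + Pi.single i 1) (castM s') with hO
    have hOe : ∀ a b : Fin 16, O (cfgEquiv a) (cfgEquiv b) =
        if agree2 (posEquiv p) (pflip i (posEquiv p)) a b = true then
          ((s (fbit (posEquiv p) a) (fbit (posEquiv p) b) : ℤ) : ℂ) *
            ((s' (fbit (pflip i (posEquiv p)) a) (fbit (pflip i (posEquiv p)) b) : ℤ) : ℂ)
        else 0 := by
      intro a b
      rw [hO, onSite_mul_onSite_cfgEquiv (add_single_ne p i), posEquiv_add_single, castM_apply,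
        castM_apply]
    simp only [Matrix.mul_apply, sum_cfg, conjTranspose_apply, UC_cfgEquiv, star_intCast, hOe]
    push_cast [XBIdir, os2I_cast]
    rfl
  unfold uHat
  simp only [onSite_smul, conjTranspose_smul, Matrix.smul_mul, Matrix.mul_smul, smul_smul,
    Matrix.smul_apply, smul_eq_mul]
  rw [hcore, XBIdir_eq_XBI _ _ (pflip_ne i (posEquiv p)).symm, Complex.star_def, map_inv₀,
    map_natCast]
  have hS := SCALE_cast_ne_zero
  field_simp

/-! ### The contraction sums -/

/-- **A-bond contraction sum** of the circuit state. [folklore] -/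
theorem fdcSumA_phiHat (p : FdcP) (i : Fin 2) (t : Fin 3) (κ₁ κ₂ : ℂ) :
    fdcSumA phiHat i (uHatᴴ * onSite p (κ₁ • castM (spin1 t)) * uHat)
        (uHatᴴ * onSite (p + Pi.single i 1) (κ₂ • castM (spin2 t)) * uHat) =
      κ₁ * κ₂ * ((IAdir i (posEquiv p) t : ℤ) : ℂ) / ((SCALE : ℂ) ^ 4 * (N2 : ℂ) ^ 8) := by
  have hD : ∀ (m : Fin 4) (a a' c c' : Fin 2),
      (if posEquiv.symm m i = 0 then
          fdcD phiHat (posEquiv.symm m) a a' (posEquiv.symm m + Pi.single i 1) c c'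
        else fdcS phiHat (posEquiv.symm m) a a') =
      (if pbit i m = 0 then ((DIlit i m a a' c c' : ℤ) : ℂ) else ((SIlit m a a' : ℤ) : ℂ)) *
        (N2 : ℂ)⁻¹ := by
    intro m a a' c c'
    by_cases h : pbit i m = 0
    · rw [if_pos ((posEquiv_symm_apply_eq_zero_iff m i).2 h), if_pos h,
        fdcD_phiHat _ i ((posEquiv_symm_apply_eq_zero_iff m i).2 h), Equiv.apply_symm_apply,
        div_eq_mul_inv]
    · rw [if_neg (mt (posEquiv_symm_apply_eq_zero_iff m i).1 h), if_neg h, fdcS_phiHat,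
        Equiv.apply_symm_apply, div_eq_mul_inv]
  have hS : ∀ (m : Fin 4) (a a' : Fin 2),
      (if posEquiv.symm m i = 0 then fdcS phiHat (posEquiv.symm m) a a' else 1) =
      (if pbit i m = 0 then ((SIlit m a a' : ℤ) : ℂ) else ((N2 : ℕ) : ℂ)) * (N2 : ℂ)⁻¹ := by
    intro m a a'
    by_cases h : pbit i m = 0
    · rw [if_pos ((posEquiv_symm_apply_eq_zero_iff m i).2 h), if_pos h, fdcS_phiHat,
        Equiv.apply_symm_apply, div_eq_mul_inv]
    · rw [if_neg (mt (posEquiv_symm_apply_eq_zero_iff m i).1 h), if_neg h,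
        mul_inv_cancel₀ N2_cast_ne_zero]
  have hI : ((IAdir i (posEquiv p) t : ℤ) : ℂ) =
      ∑ j₂ : Fin 16, ∑ j₂' : Fin 16, ∑ j₁ : Fin 16, ∑ j₁' : Fin 16,
        ((XI (pflip i (posEquiv p)) (spin2 t) j₂ j₂' : ℤ) : ℂ) *
          (((XI (posEquiv p) (spin1 t) j₁ j₁' : ℤ) : ℂ) *
            ((∏ m : Fin 4, if pbit i m = 0 then
                ((DIlit i m (fbit m j₁) (fbit m j₁') (fbit (pflip i m) j₂) (fbit (pflip i m) j₂') : ℤ) : ℂ)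
              else ((SIlit m (fbit m j₁) (fbit m j₁') : ℤ) : ℂ)) *
             ∏ m : Fin 4, if pbit i m = 0 then ((SIlit m (fbit m j₂) (fbit m j₂') : ℤ) : ℂ)
              else ((N2 : ℕ) : ℂ))) := by
    push_cast [IAdir, P1I, P2I]
    rfl
  unfold fdcSumA
  simp only [sum_cfg, prod_pos, conj_onSite_entry, cfgEquiv_apply, Equiv.apply_symm_apply,
    posEquiv_add_single]
  simp only [hD, hS]
  simp only [prod_mul_distrib, prod_const, card_univ, Fintype.card_fin]
  rw [hI]
  simp only [Finset.mul_sum, Finset.sum_div]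
  refine sum_congr rfl fun j₂ _ => sum_congr rfl fun j₂' _ => sum_congr rfl fun j₁ _ =>
    sum_congr rfl fun j₁' _ => ?_
  ring

/-- **B-bond contraction sum** of the circuit state. [folklore] -/
theorem fdcSumB_phiHat (p : FdcP) (i : Fin 2) (t : Fin 3) (κ₁ κ₂ : ℂ) :
    fdcSumB phiHat (uHatᴴ * (onSite p (κ₁ • castM (spin1 t)) *
        onSite (p + Pi.single i 1) (κ₂ • castM (spin2 t))) * uHat : Op FdcP 2) =
      κ₁ * κ₂ * ((IB (posEquiv p) i t : ℤ) : ℂ) / ((SCALE : ℂ) ^ 2 * (N2 : ℂ) ^ 4) := by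
  have hS : ∀ (m : Fin 4) (a a' : Fin 2),
      fdcS phiHat (posEquiv.symm m) a a' = ((SIlit m a a' : ℤ) : ℂ) * (N2 : ℂ)⁻¹ := by
    intro m a a'
    rw [fdcS_phiHat, Equiv.apply_symm_apply, div_eq_mul_inv]
  have hI : ((IB (posEquiv p) i t : ℤ) : ℂ) = ∑ j : Fin 16, ∑ j' : Fin 16,
      ((XBI (posEquiv p) (spin1 t) (pflip i (posEquiv p)) (spin2 t) j j' : ℤ) : ℂ) *
        ∏ m : Fin 4, ((SIlit m (fbit m j) (fbit m j') : ℤ) : ℂ) := by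
    push_cast [IB]
    rfl
  unfold fdcSumB
  simp only [sum_cfg, prod_pos, conj_onSite_onSite_entry, cfgEquiv_apply, Equiv.apply_symm_apply]
  simp only [hS, prod_mul_distrib, prod_const, card_univ, Fintype.card_fin]
  rw [hI]
  simp only [Finset.mul_sum, Finset.sum_div]
  refine sum_congr rfl fun j _ => sum_congr rfl fun j' _ => ?_
  ring

/-! ### Spin-½ matrices, bond values and the energy formula -/

/-- `Sᶻ = ½ · sz2` (spin ½). [folklore] -/
theorem spinZ_one_eq : SpinOperators.spinZ 1 = (1 / 2 : ℂ) • castM sz2 := by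
  ext a b
  fin_cases a <;> fin_cases b <;> norm_num [spinZ_apply, castM, sz2]

/-- `S⁺ = sp` (spin ½). [folklore] -/
theorem spinRaise_one_eq : spinRaise 1 = (1 : ℂ) • castM sp := by
  ext a b
  fin_cases a <;> fin_cases b <;> simp [spinRaise_apply, castM, sp]

/-- `S⁻ = sm` (spin ½). [folklore] -/
theorem spinLower_one_eq : spinLower 1 = (1 : ℂ) • castM sm := by
  rw [spinLower_eq_conjTranspose, spinRaise_one_eq]
  ext a b
  fin_cases a <;> fin_cases b <;> simp [castM, sp, sm, conjTranspose_apply]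

/-- **Pair expectations** of the circuit state, term `t`. [folklore] -/
theorem fdcPair_phiHat (p : FdcP) (i : Fin 2) (t : Fin 3) (κ₁ κ₂ : ℂ) :
    fdcPair phiHat uHat p i (κ₁ • castM (spin1 t)) (κ₂ • castM (spin2 t)) =
      if pbit i (posEquiv p) = 0 then
        κ₁ * κ₂ * ((IAdir i (posEquiv p) t : ℤ) : ℂ) / ((SCALE : ℂ) ^ 4 * (N2 : ℂ) ^ 8)
      else κ₁ * κ₂ * ((IB (posEquiv p) i t : ℤ) : ℂ) / ((SCALE : ℂ) ^ 2 * (N2 : ℂ) ^ 4) := by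
  unfold fdcPair
  by_cases hp : p i = 0
  · rw [if_pos hp, if_pos ((posEquiv_apply_eq_zero_iff p i).1 hp), fdcSumA_phiHat]
  · rw [if_neg hp, if_neg (mt (posEquiv_apply_eq_zero_iff p i).2 hp), fdcSumB_phiHat]

/-- The bond value of class `(m, i)` as a real number, in terms of the 24 integer sums. [folklore] -/
def bondVal (m : Fin 4) (i : Fin 2) : ℝ :=
  if pbit i m = 0 then
    (((IAdir i m 0 : ℤ) : ℝ) / 4 + (((IAdir i m 1 : ℤ) : ℝ) + ((IAdir i m 2 : ℤ) : ℝ)) / 2) /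
      ((SCALE : ℝ) ^ 4 * (N2 : ℝ) ^ 8)
  else
    (((IB m i 0 : ℤ) : ℝ) / 4 + (((IB m i 1 : ℤ) : ℝ) + ((IB m i 2 : ℤ) : ℝ)) / 2) /
      ((SCALE : ℝ) ^ 2 * (N2 : ℝ) ^ 4)

/-- **Bond values** of the circuit state. [folklore] -/
theorem fdcBond_phiHat (p : FdcP) (i : Fin 2) :
    fdcBond 1 phiHat uHat p i = ((bondVal (posEquiv p) i : ℝ) : ℂ) := by
  have e0 : fdcPair phiHat uHat p i (SpinOperators.spinZ 1) (SpinOperators.spinZ 1) =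
      fdcPair phiHat uHat p i ((1 / 2 : ℂ) • castM (spin1 0)) ((1 / 2 : ℂ) • castM (spin2 0)) := by
    rw [spinZ_one_eq]; rfl
  have e1 : fdcPair phiHat uHat p i (spinRaise 1) (spinLower 1) =
      fdcPair phiHat uHat p i ((1 : ℂ) • castM (spin1 1)) ((1 : ℂ) • castM (spin2 1)) := by
    rw [spinRaise_one_eq, spinLower_one_eq]; rfl
  have e2 : fdcPair phiHat uHat p i (spinLower 1) (spinRaise 1) =
      fdcPair phiHat uHat p i ((1 : ℂ) • castM (spin1 2)) ((1 : ℂ) • castM (spin2 2)) := by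
    rw [spinRaise_one_eq, spinLower_one_eq]; rfl
  unfold fdcBond
  rw [e0, e1, e2, fdcPair_phiHat, fdcPair_phiHat, fdcPair_phiHat]
  unfold bondVal
  by_cases h : pbit i (posEquiv p) = 0
  · simp only [if_pos h]
    push_cast
    ring
  · simp only [if_neg h]
    push_cast
    ring

/-- **The FDC energy of the circuit `F31`** as a rational function of the 24 integer sums
`IAdir`, `IB`. [folklore] -/
theorem fdcEnergy_phiHat_uHat : fdcEnergy 1 phiHat uHat = ∑ m : Fin 4, ∑ i : Fin 2, bondVal m i := by
  unfold fdcEnergy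
  rw [← Equiv.sum_comp posEquiv.symm]
  refine sum_congr rfl fun m _ => sum_congr rfl fun i _ => ?_
  rw [fdcBond_phiHat, Equiv.apply_symm_apply, Complex.ofReal_re]

end

end Summit.HubbardSuperconductivity.HubbardLadder.Bounds
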